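import Mathlib
import Summits.Ventures.HodgeRepro.Tier4.Line1.RTFSetting
import Summits.Ventures.HodgeRepro.Tier4.Line1.RtfUnfold
import Summits.Ventures.HodgeRepro.Tier4.Line1.RtfSpectralStep
import Summits.Ventures.HodgeRepro.Tier4.Line1.PairOrbitalWindow

/-!
# Tier4/Line1/PairOrbitalPositivity — LINE L1, towards J2.c′: the positivity step R7

Blind re-derivation cell `pub-hodge-repro`, Tier 4 «prove the step» (README §9–§10), seat t4-L1-p4 (prover, gen 0;
lead S12295: t4-L1-p4 = J2.c′ `exists_pair_orbital_ne_zero`, Skeleton v0.10 3d8356354c198ec9 L531–L538 = v0.11).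
LINE L1 = the relative-trace-formula line of t4-plan-1; generic layer `Tier4/Line1/RTFSetting.lean` (plan-1),
`Tier4/Line1/RtfUnfold.lean` and `Tier4/Line1/RtfSpectralStep.lean` (t4-L1-p4, L1.2b), imported BY NAME.
Paper proof and rung cut: proofs/t4/L1/J2c.md.  THE PLAN (a repair of the skeleton's docstring plan: NO conjugate
phase extension, NO Tietze, NO approximate identity): `f₁, f₂` are non-negative bumps at `γ₀`, `1`; `f = f₁ ⋆ f₂ ≥ 0`
is a test function positive near `γ₀` and supported in a small open `V ∋ γ₀`; on `DT × DT′` only finitely many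
orbit elements contribute and, by a compactness argument (`exists_open_phase_re_gt`), every contributing phase
`χ(t) conj χ′(t′)` has real part `> 1/2` once `V` is small, so `Re (orbital f) ≥ ½ ∫∫ ∑_γ f(t⁻¹γt′) > 0`
(`orbitSum_integral_pos`: rational translates + `[Countable Gk]`).

This module (3 of 4): `integrableOn_DT` / `integrableOn_DT'`, `restrict_DT_apply_of_subset`, and R7
`orbitSum_integral_pos` (`[Countable Gk]`): for a non-negative continuous compactly supported `c` positive on an open
`N ∋ γ₀`, `0 < ∫_{DT} ∫_{DT′} ∑_{γ ∈ [γ₀]} c(t⁻¹ γ t′)` — near `(1, 1)` the orbit map lands in `N`, rational translates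
(one each, by countability) bring sets of positive measure into `DT`, `DT′`, where the term `γ = δ γ₀ δ′⁻¹` is
positive; the inner integral is continuous in `t` on `closure DT` (`continuous_setIntegral_orbit_real`), so both
iterated integrals are positive.

Nothing here says anything about the status of the Hodge conjecture for CM abelian varieties, which is NOT proved;
HC_CM is NOT proved by anyone in this repository.
-/

set_option autoImplicit false

noncomputable section

namespace Summit.Ventures.HodgeRepro.Tier4.Line1

open MeasureTheory Topology Filter Set
open scoped Uniformity Pointwise InnerProductSpace ComplexConjugate

namespace RTF

variable {G : Type} [Group G] [TopologicalSpace G] [IsTopologicalGroup G] [MeasurableSpace G]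
  [BorelSpace G]

namespace Setting

variable (S : Setting G)


omit [IsTopologicalGroup G] in
/-- continuous functions on `T` are integrable on `DT` (relatively compact, `μT` finite on compacts). -/
theorem integrableOn_DT {E : Type} [NormedAddCommGroup E] {ψ : S.T → E} (hψ : Continuous ψ) :
    IntegrableOn ψ S.DT S.μT := by
  haveI := S.haarT
  exact (hψ.continuousOn.integrableOn_compact' S.compT isClosed_closure.measurableSet).mono_set
    subset_closure

omit [IsTopologicalGroup G] in
/-- continuous functions on `T'` are integrable on `DT'`. -/
theorem integrableOn_DT' {E : Type} [NormedAddCommGroup E] {ψ : S.T' → E} (hψ : Continuous ψ) :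
    IntegrableOn ψ S.DT' S.μT' := by
  haveI := S.haarT'
  exact (hψ.continuousOn.integrableOn_compact' S.compT' isClosed_closure.measurableSet).mono_set
    subset_closure

omit [IsTopologicalGroup G] [BorelSpace G] in
/-- a subset of `DT` has the same `μT`-measure for the restriction to `DT`. -/
theorem restrict_DT_apply_of_subset {A : Set S.T} (hA : A ⊆ S.DT) :
    (S.μT.restrict S.DT) A = S.μT A := by
  rw [Measure.restrict_apply₀' S.fdT.nullMeasurableSet, Set.inter_eq_left.mpr hA]

omit [IsTopologicalGroup G] [BorelSpace G] in
/-- a subset of `DT'` has the same `μT'`-measure for the restriction to `DT'`. -/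
theorem restrict_DT'_apply_of_subset {A : Set S.T'} (hA : A ⊆ S.DT') :
    (S.μT'.restrict S.DT') A = S.μT' A := by
  rw [Measure.restrict_apply₀' S.fdT'.nullMeasurableSet, Set.inter_eq_left.mpr hA]

open scoped Classical in
/-- R7 (THE POSITIVITY STEP, `[Countable Gk]`): for a non-negative continuous compactly supported `c`
positive on an open `N ∋ γ₀`, the iterated integral over `DT × DT'` of the orbit sum
`∑_{γ ∈ [γ₀]} c(t⁻¹ γ t')` is positive.  Near `(1, 1)` the orbit map lands in `N`; rational translates
`δ`, `δ'` (one each, by countability) bring sets of positive measure into `DT`, `DT'`, where the term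
`γ = δ γ₀ δ'⁻¹` of the orbit sum is positive; the inner integral is continuous in `t` (a finite sum of
`continuous_setIntegral_orbit_real` on `closure DT`), so both iterated integrals are positive. -/
theorem orbitSum_integral_pos [Countable S.Gk] (γ₀ : S.Gk) {c : G → ℝ} (hc : Continuous c)
    (hcs : HasCompactSupport c) (hc0 : ∀ x, 0 ≤ c x) {N : Set G} (hN : IsOpen N)
    (hγN : (γ₀ : G) ∈ N) (hpos : ∀ x ∈ N, 0 < c x) :
    0 < ∫ t in S.DT, ∫ t' in S.DT', ∑' γ : {γ : S.Gk // S.orbitOf γ = S.orbitOf γ₀},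
      c ((t : G)⁻¹ * γ.1 * t') ∂S.μT' ∂S.μT := by
  haveI := S.haarT
  haveI := S.haarT'
  set o := S.orbitOf γ₀ with ho
  have hV₀ : IsCompact (tsupport c) := hcs
  -- Step 1: neighbourhoods `W₁ ∋ 1`, `W₂ ∋ 1` with `W₁⁻¹ γ₀ W₂ ⊆ N`
  have hcont : Continuous fun p : S.T × S.T' => (p.1 : G)⁻¹ * γ₀ * p.2 :=
    ((continuous_subtype_val.comp continuous_fst).inv.mul continuous_const).mul
      (continuous_subtype_val.comp continuous_snd)
  have hmem : (fun p : S.T × S.T' => (p.1 : G)⁻¹ * γ₀ * p.2) ⁻¹' N ∈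
      𝓝 ((1 : S.T), (1 : S.T')) := by
    apply hcont.continuousAt.preimage_mem_nhds
    simp only [OneMemClass.coe_one, inv_one, one_mul, mul_one]
    exact hN.mem_nhds hγN
  rw [mem_nhds_prod_iff] at hmem
  obtain ⟨u, hu, v, hv, huv⟩ := hmem
  obtain ⟨W₁, hW₁u, hW₁o, h1W₁⟩ := mem_nhds_iff.mp hu
  obtain ⟨W₂, hW₂v, hW₂o, h1W₂⟩ := mem_nhds_iff.mp hv
  have hW : ∀ x ∈ W₁, ∀ x' ∈ W₂, (x : G)⁻¹ * γ₀ * x' ∈ N := fun x hx x' hx' =>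
    huv (Set.mk_mem_prod (hW₁u hx) (hW₂v hx'))
  -- Step 2: the rational translates
  obtain ⟨δ, hδ⟩ := S.exists_rational_translate_pos (hW₁o.measure_pos S.μT ⟨1, h1W₁⟩)
  obtain ⟨δ', hδ'⟩ := S.exists_rational_translate_pos' (hW₂o.measure_pos S.μT' ⟨1, h1W₂⟩)
  set A : Set S.T := (fun x : S.T => (δ : S.T) * x) '' {x ∈ W₁ | δ • x ∈ S.DT} with hAdef
  set A' : Set S.T' := (fun x : S.T' => (δ' : S.T') * x) '' {x ∈ W₂ | δ' • x ∈ S.DT'} with hA'def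
  have hA : A ⊆ S.DT := by
    rintro _ ⟨x, hx, rfl⟩
    exact hx.2
  have hA' : A' ⊆ S.DT' := by
    rintro _ ⟨x, hx, rfl⟩
    exact hx.2
  have hAμ : 0 < S.μT A := by rw [hAdef, S.measure_image_mul_left_T]; exact hδ
  have hA'μ : 0 < S.μT' A' := by rw [hA'def, S.measure_image_mul_left_T']; exact hδ'
  -- Step 3: the rational element `γ = δ γ₀ δ'⁻¹` of the orbit
  set dG : S.Gk := ⟨((δ : S.T) : G), Subgroup.mem_subgroupOf.mp δ.2⟩ with hdG
  set dG' : S.Gk := ⟨((δ' : S.T') : G), Subgroup.mem_subgroupOf.mp δ'.2⟩ with hdG'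
  set γ : S.Gk := dG * γ₀ * dG'⁻¹ with hγdef
  have hγo : S.orbitOf γ = o := by
    rw [ho]
    unfold orbitOf
    rw [DoubleCoset.eq]
    refine ⟨dG⁻¹, ?_, dG', ?_, ?_⟩
    · rw [Subgroup.mem_subgroupOf, Subgroup.coe_inv]
      exact S.T.inv_mem (δ : S.T).2
    · rw [Subgroup.mem_subgroupOf]
      exact (δ' : S.T').2
    · rw [hγdef]
      group
  have hin : ∀ t ∈ A, ∀ t' ∈ A', (t : G)⁻¹ * γ * t' ∈ N := by
    rintro _ ⟨x, hx, rfl⟩ _ ⟨x', hx', rfl⟩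
    have := hW x hx.1 x' hx'.1
    convert this using 1
    simp only [hγdef, hdG, hdG', Subgroup.coe_mul, Subgroup.coe_inv]
    group
  -- Step 4: the orbit sum `F`, its finite form on `closure DT × closure DT'`
  set Γ := (S.finite_window (tsupport c) hV₀).toFinset.subtype (fun γ => S.orbitOf γ = o) with hΓ
  set F : S.T → S.T' → ℝ := fun t t' =>
    ∑' γ' : {γ' : S.Gk // S.orbitOf γ' = o}, c ((t : G)⁻¹ * γ'.1 * t') with hF
  have hF0 : ∀ t t', 0 ≤ F t t' := fun t t' => tsum_nonneg fun _ => hc0 _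
  have hFsum : ∀ t ∈ closure S.DT, ∀ t' ∈ closure S.DT',
      F t t' = ∑ γ' ∈ Γ, c ((t : G)⁻¹ * γ'.1 * t') := fun t ht t' ht' =>
    S.orbitSum_eq_sum hV₀ subset_rfl o ht ht'
  have hFle : ∀ t ∈ closure S.DT, ∀ t' ∈ closure S.DT', c ((t : G)⁻¹ * γ * t') ≤ F t t' := by
    intro t ht t' ht'
    exact (S.orbitSum_summable hV₀ subset_rfl o ht ht').le_tsum ⟨γ, hγo⟩ fun _ _ => hc0 _
  have hcγ : ∀ γ' : G, Continuous fun p : S.T × S.T' => c ((p.1 : G)⁻¹ * γ' * p.2) := fun γ' =>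
    hc.comp (((continuous_subtype_val.comp continuous_fst).inv.mul continuous_const).mul
      (continuous_subtype_val.comp continuous_snd))
  -- Step 5: the inner integral `I t`, its integrability and positivity on `A`
  have hFi : ∀ t ∈ closure S.DT, IntegrableOn (F t) S.DT' S.μT' := by
    intro t ht
    refine Integrable.congr (f := fun t' : S.T' => ∑ γ' ∈ Γ, c ((t : G)⁻¹ * γ'.1 * t')) ?_ ?_
    · exact S.integrableOn_DT' (continuous_finsetSum _ fun γ' _ =>
        hc.comp (continuous_const.mul continuous_subtype_val))
    · filter_upwards [ae_restrict_mem₀ S.fdT'.nullMeasurableSet] with t' ht'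
      exact (hFsum t ht t' (subset_closure ht')).symm
  set I : S.T → ℝ := fun t => ∫ t' in S.DT', F t t' ∂S.μT' with hI
  have hI0 : ∀ t, 0 ≤ I t := fun t => integral_nonneg fun t' => hF0 t t'
  have hIpos : ∀ t ∈ A, 0 < I t := by
    intro t ht
    have htc : t ∈ closure S.DT := subset_closure (hA ht)
    show 0 < ∫ t' in S.DT', F t t' ∂S.μT'
    rw [integral_pos_iff_support_of_nonneg (fun t' => hF0 t t') (hFi t htc)]
    calc 0 < S.μT' A' := hA'μ
      _ = (S.μT'.restrict S.DT') A' := (S.restrict_DT'_apply_of_subset hA').symm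
      _ ≤ (S.μT'.restrict S.DT') (Function.support (F t)) := by
          apply measure_mono
          intro t' ht'
          exact ((hpos _ (hin t ht t' ht')).trans_le (hFle t htc t' (subset_closure (hA' ht')))).ne'
  -- Step 6: the outer integral
  have hIi : IntegrableOn I S.DT S.μT := by
    refine Integrable.congr
      (f := fun t : S.T => ∑ γ' ∈ Γ, ∫ t' in S.DT', c ((t : G)⁻¹ * γ'.1 * t') ∂S.μT') ?_ ?_
    · exact S.integrableOn_DT (continuous_finsetSum _ fun γ' _ =>
        S.continuous_setIntegral_orbit_real hc hcs γ'.1)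
    · filter_upwards [ae_restrict_mem₀ S.fdT.nullMeasurableSet] with t ht
      have htc : t ∈ closure S.DT := subset_closure ht
      have hae : (fun t' : S.T' => ∑ γ' ∈ Γ, c ((t : G)⁻¹ * γ'.1 * t')) =ᵐ[S.μT'.restrict S.DT']
          F t := by
        filter_upwards [ae_restrict_mem₀ S.fdT'.nullMeasurableSet] with t' ht'
        exact (hFsum t htc t' (subset_closure ht')).symm
      show ∑ γ' ∈ Γ, ∫ t' in S.DT', c ((t : G)⁻¹ * γ'.1 * t') ∂S.μT' = ∫ t' in S.DT', F t t' ∂S.μT'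
      rw [← integral_congr_ae hae, integral_finsetSum]
      intro γ' _
      exact S.integrableOn_DT' (hc.comp (continuous_const.mul continuous_subtype_val))
  show 0 < ∫ t in S.DT, I t ∂S.μT
  rw [integral_pos_iff_support_of_nonneg hI0 hIi]
  calc 0 < S.μT A := hAμ
    _ = (S.μT.restrict S.DT) A := (S.restrict_DT_apply_of_subset hA).symm
    _ ≤ (S.μT.restrict S.DT) (Function.support I) :=
        measure_mono fun t ht => (hIpos t ht).ne'

end Setting

end RTF

end Summit.Ventures.HodgeRepro.Tier4.Line1
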